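import Literature.MathematicalPhysics.QuantumLattice.SpectralCorrelationInequalities
import Mathlib.Analysis.SpecialFunctions.Trigonometric.Deriv
import HarnessLib

/-!
# Dictionary of closed-form KMS-moment rows: positive exponential polynomials of Itoi–Ishimori–Sato–Sakamoto type

Topic `Literature/MathematicalPhysics/QuantumLattice`; companion of `SpectralCorrelationInequalities.lean`
(`Matrix.IsHermitian.kmsMomentRow_nonneg`), `GibbsKMSMomentCutsSector.lean`
(`sum_exp_mul_re_expect_momentRow_nonneg`) and `InfVolFermionStateTorusLimitKMSMomentCuts.lean`
(`IsTorusLimitOfMixture.re_expect_momentRow_nonneg_of_sectorGibbs`). Those theorems turn ANY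
coefficient vectors `p q : Fin (K+1) → ℝ` with

  `∀ u : ℝ, 0 ≤ (Σ_k p_k u^k) + e^{−u} (Σ_k q_k u^k)`            (dimensionless, `u = βω`)

into the linear KMS constraint `0 ≤ Σ_k β^k [p_k ω(a† ad_H^k a) + q_k ω(ad_H^k(a) a†)]` on the state. This
file is the DICTIONARY of named closed-form members — the positivity hypothesis PROVED for the explicit
`p, q` of published correlation inequalities — so that a certificate reader cites a member by name
(hubbard-thermal THERMAL-SOURCES §2k). The members linear in word expectations are the truncations of
Itoi–Ishimori–Sato–Sakamoto's Theorem 3,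

  `⟨[A†,[H,A]]⟩ ≶ Σ_{k=0}^{m} (g^{(2k)}(0)/(2k)!) (β/2)^{2k+1} ⟨{C_A^{k+1}†, C_A^{k+1}}⟩`,
  `g(z) = tanh z / z = 1 − z²/3 + 2z⁴/15 − ⋯`, `C_A^k = ad_H^k A`

(`≤` for `m` even, `≥` for `m` odd; [ItoiEtAl2023] Thm 3 with `n = 2m` resp. `n = 2m − 2`), whose
spectral content is the sign of the Taylor remainders of `tanh` (their Lemma 6: `g_n ≤ 0` for `n/2`
even, `g_n ≥ 0` for `n/2` odd). In the dimensionless variable the member `m` reads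
`Π_m(u) = u·[S_m(u/2)(1 + e^{−u}) − (1 − e^{−u})] ≥ 0` (`m` even; opposite sign for `m` odd), where
`S_m` is the Taylor polynomial of `tanh` of degree `2m+1`; `Π_m(u) = 4z e^{−z}(S_m(z) cosh z − sinh z)`,
`z = u/2`.

* §1 Taylor bounds for `tanh` on `z ≥ 0` in `sinh/cosh` form (no division):
  `mul_cosh_sub_sinh_nonneg` (`tanh z ≤ z`), `sinh_sub_taylor3_mul_cosh_nonneg` (`z − z³/3 ≤ tanh z`),
  `taylor5_mul_cosh_sub_sinh_nonneg` (`tanh z ≤ z − z³/3 + 2z⁵/15`) — each by `f(0) = 0`, `f' ≥ 0`.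
* §2 the members in the `(p, q)` format above, with the coefficient vectors spelled out:
  `kmsMomentRow_itoi3_n0`     — `K = 2`, `p = (0, −1, ½)`,              `q = (0, 1, ½)`        (Thm 3, `n = 0`, upper);
  `kmsMomentRow_itoi3_n0_lower` — `K = 4`, `p = (0, 1, −½, 0, 1/24)`,   `q = (0, −1, −½, 0, 1/24)` (Thm 3, `n = 0`, lower);
  `kmsMomentRow_itoi3_n4`     — `K = 6`, `p = (0, −1, ½, 0, −1/24, 0, 1/240)`, `q = (0, 1, ½, 0, −1/24, 0, 1/240)`
  (Thm 3, `n = 4`, upper); each preceded by its clean form `…_aux` in the variable `u`.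
* §3 the bridge `Matrix.adPow_eq_commutator_iterate` : `adPow H k a = (X ↦ HX − XH)^[k] a` between the two
  spellings of `ad_H^k` in the tree.

Everything is PROVED; no definition, no named fact. The `K = 1` tangent rows (linearised EEB) are
`sub_add_mul_exp_neg_nonneg_of_exp_le` (`GibbsEnergyEntropyBalance.lean`) and are not repeated.

## Mathlib / tree search

`lean search 'sinh_le|le_sinh|sinh_lt|tanh_le|tanh_lt|le_tanh' --decl`: only private copies of
`tanh y < y` (`Literature/Analysis/FluidPDE/SawtoothCascade.lean`) and `z/(1+z) ≤ tanh z`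
(`Literature/Analysis/ODE/RecessiveDominanceSubBarrier.lean`); Mathlib has `Real.hasDerivAt_sinh/cosh`,
`Real.sinh_nonneg_iff`, `Real.cosh_pos`, `Real.cosh_eq`, `Real.sinh_eq`, `Real.cosh_neg`, `Real.sinh_neg`,
`monotoneOn_of_deriv_nonneg` — used here. REUSED: `Matrix.adPow`, `Matrix.adPow_succ`
(`SpectralCorrelationInequalities`).

## References

* C. Itoi, H. Ishimori, K. Sato, Y. Sakamoto, *Extended series of correlation inequalities in quantum
  systems*, J. Phys. Soc. Jpn. 92 (2023) 074001 = arXiv:2306.03489, §2 Thm 3, §3 Lemma 6 and the proof of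
  Thm 3 (p. 9). [cite: ItoiEtAl2023, Thm 3]
-/

namespace Literature.MathematicalPhysics.QuantumLattice

open Finset
open scoped BigOperators

/-! ### §1 Taylor bounds for `tanh` in `sinh/cosh` form -/

section TanhTaylor

/-- `f(0) = 0` and `f' ≥ 0` on `[0, ∞)` give `f ≥ 0` on `[0, ∞)`. [folklore] -/
private theorem nonneg_of_hasDerivAt_nonneg_dict {f f' : ℝ → ℝ} (hf : ∀ x, HasDerivAt f (f' x) x)
    (h0 : f 0 = 0) (hpos : ∀ x, 0 ≤ x → 0 ≤ f' x) {x : ℝ} (hx : 0 ≤ x) : 0 ≤ f x := by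
  have hmono : MonotoneOn f (Set.Ici 0) := by
    refine monotoneOn_of_deriv_nonneg (convex_Ici 0)
      (fun u _ => (hf u).continuousAt.continuousWithinAt)
      (fun u _ => (hf u).differentiableAt.differentiableWithinAt) ?_
    intro u hu
    rw [interior_Ici] at hu
    rw [(hf u).deriv]
    exact hpos u (le_of_lt hu)
  have h := hmono Set.self_mem_Ici (Set.mem_Ici.2 hx) hx
  rwa [h0] at h

/-- **`tanh z ≤ z`** (`z ≥ 0`), division-free: `0 ≤ z cosh z − sinh z` (derivative `z sinh z ≥ 0`);
the sign `g_0 = g − 1 ≤ 0` of Itoi et al. Lemma 6. [cite: ItoiEtAl2023, §3 Lemma 6] -/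
theorem mul_cosh_sub_sinh_nonneg {z : ℝ} (hz : 0 ≤ z) : 0 ≤ z * Real.cosh z - Real.sinh z := by
  refine nonneg_of_hasDerivAt_nonneg_dict (f := fun z => z * Real.cosh z - Real.sinh z)
    (f' := fun z => z * Real.sinh z) (fun x => ?_) (by simp)
    (fun x hx => mul_nonneg hx (Real.sinh_nonneg_iff.2 hx)) hz
  have h := ((hasDerivAt_id x).fun_mul (Real.hasDerivAt_cosh x)).fun_sub (Real.hasDerivAt_sinh x)
  refine h.congr_deriv ?_
  simp only [id_eq]
  ring

/-- **`z − z³/3 ≤ tanh z`** (`z ≥ 0`), division-free: `0 ≤ sinh z − (z − z³/3) cosh z` (derivative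
`z(z cosh z − sinh z) + (z³/3) sinh z ≥ 0`); the sign `g_2 ≥ 0` of Itoi et al. Lemma 6.
[cite: ItoiEtAl2023, §3 Lemma 6] -/
theorem sinh_sub_taylor3_mul_cosh_nonneg {z : ℝ} (hz : 0 ≤ z) :
    0 ≤ Real.sinh z - (z - z ^ 3 / 3) * Real.cosh z := by
  refine nonneg_of_hasDerivAt_nonneg_dict (f := fun z => Real.sinh z - (z - z ^ 3 / 3) * Real.cosh z)
    (f' := fun z => z * (z * Real.cosh z - Real.sinh z) + z ^ 3 / 3 * Real.sinh z) (fun x => ?_) (by simp)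
    (fun x hx => add_nonneg (mul_nonneg hx (mul_cosh_sub_sinh_nonneg hx))
      (mul_nonneg (by positivity) (Real.sinh_nonneg_iff.2 hx))) hz
  have h := (Real.hasDerivAt_sinh x).fun_sub
    (((hasDerivAt_id x).fun_sub ((hasDerivAt_pow 3 x).div_const 3)).fun_mul (Real.hasDerivAt_cosh x))
  refine h.congr_deriv ?_
  simp only [id_eq, Nat.cast_ofNat, Nat.reduceSub]
  ring

/-- **`tanh z ≤ z − z³/3 + 2z⁵/15`** (`z ≥ 0`), division-free:
`0 ≤ (z − z³/3 + 2z⁵/15) cosh z − sinh z`; the sign `g_4 ≤ 0` of Itoi et al. Lemma 6. Proof: with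
`λ(z) = (5z/3 + 2z³/15) cosh z − (5/3 − 6z²/5) sinh z` (`λ' = (8z²/5) cosh z + (61z/15 + 2z³/15) sinh z ≥ 0`)
and `κ(z) = (1 − z²/3 + 2z⁴/15) sinh z − (z − 2z³/3) cosh z` (`κ' = zλ`), the derivative of the claim is
`zκ ≥ 0`. [cite: ItoiEtAl2023, §3 Lemma 6] -/
theorem taylor5_mul_cosh_sub_sinh_nonneg {z : ℝ} (hz : 0 ≤ z) :
    0 ≤ (z - z ^ 3 / 3 + 2 * z ^ 5 / 15) * Real.cosh z - Real.sinh z := by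
  -- λ ≥ 0
  have hl : ∀ x, 0 ≤ x →
      0 ≤ (5 * x / 3 + 2 * x ^ 3 / 15) * Real.cosh x - (5 / 3 - 6 * x ^ 2 / 5) * Real.sinh x := by
    intro x hx
    refine nonneg_of_hasDerivAt_nonneg_dict
      (f := fun x => (5 * x / 3 + 2 * x ^ 3 / 15) * Real.cosh x - (5 / 3 - 6 * x ^ 2 / 5) * Real.sinh x)
      (f' := fun x => 8 * x ^ 2 / 5 * Real.cosh x + (61 * x / 15 + 2 * x ^ 3 / 15) * Real.sinh x)
      (fun y => ?_) (by simp) (fun y hy => add_nonneg (mul_nonneg (by positivity) (Real.cosh_pos y).le)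
        (mul_nonneg (by positivity) (Real.sinh_nonneg_iff.2 hy))) hx
    have d1 := (((hasDerivAt_id y).const_mul 5).div_const 3).fun_add
      (((hasDerivAt_pow 3 y).const_mul 2).div_const 15)
    have d2 := (((hasDerivAt_pow 2 y).const_mul 6).div_const 5).const_sub (5 / 3)
    have h := (d1.mul (Real.hasDerivAt_cosh y)).fun_sub (d2.mul (Real.hasDerivAt_sinh y))
    refine h.congr_deriv ?_
    simp only [id_eq, Nat.cast_ofNat, Nat.reduceSub]
    ring
  -- κ ≥ 0
  have hk : ∀ x, 0 ≤ x →
      0 ≤ (1 - x ^ 2 / 3 + 2 * x ^ 4 / 15) * Real.sinh x - (x - 2 * x ^ 3 / 3) * Real.cosh x := by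
    intro x hx
    refine nonneg_of_hasDerivAt_nonneg_dict
      (f := fun x => (1 - x ^ 2 / 3 + 2 * x ^ 4 / 15) * Real.sinh x - (x - 2 * x ^ 3 / 3) * Real.cosh x)
      (f' := fun x => x * ((5 * x / 3 + 2 * x ^ 3 / 15) * Real.cosh x - (5 / 3 - 6 * x ^ 2 / 5) * Real.sinh x))
      (fun y => ?_) (by simp) (fun y hy => mul_nonneg hy (hl y hy)) hx
    have d1 := (((hasDerivAt_pow 2 y).div_const 3).const_sub 1).fun_add
      (((hasDerivAt_pow 4 y).const_mul 2).div_const 15)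
    have d2 := (hasDerivAt_id y).fun_sub (((hasDerivAt_pow 3 y).const_mul 2).div_const 3)
    have h := (d1.mul (Real.hasDerivAt_sinh y)).fun_sub (d2.mul (Real.hasDerivAt_cosh y))
    refine h.congr_deriv ?_
    simp only [id_eq, Nat.cast_ofNat, Nat.reduceSub]
    ring
  -- the claim
  refine nonneg_of_hasDerivAt_nonneg_dict
    (f := fun x => (x - x ^ 3 / 3 + 2 * x ^ 5 / 15) * Real.cosh x - Real.sinh x)
    (f' := fun x => x * ((1 - x ^ 2 / 3 + 2 * x ^ 4 / 15) * Real.sinh x - (x - 2 * x ^ 3 / 3) * Real.cosh x))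
    (fun y => ?_) (by simp) (fun y hy => mul_nonneg hy (hk y hy)) hz
  have d1 := ((hasDerivAt_id y).fun_sub ((hasDerivAt_pow 3 y).div_const 3)).fun_add
    (((hasDerivAt_pow 5 y).const_mul 2).div_const 15)
  have h := (d1.mul (Real.hasDerivAt_cosh y)).fun_sub (Real.hasDerivAt_sinh y)
  refine h.congr_deriv ?_
  simp only [id_eq, Nat.cast_ofNat, Nat.reduceSub]
  ring

end TanhTaylor

/-! ### §2 The members in the dimensionless `(p, q)` format -/

section Members

/-- `e^{−2z} = e^{−z} e^{−z}`. [folklore] -/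
private theorem exp_neg_two_mul_dict (z : ℝ) : Real.exp (-(2 * z)) = Real.exp (-z) * Real.exp (-z) := by
  rw [← Real.exp_add]
  congr 1
  ring

/-- `e^{z} e^{−z} = 1`. [folklore] -/
private theorem exp_mul_exp_neg_dict (z : ℝ) : Real.exp z * Real.exp (-z) = 1 := by
  rw [← Real.exp_add, add_neg_cancel, Real.exp_zero]

/-- Clean form of the member «Thm 3, `n = 0`, upper bound»: `0 ≤ u·[(u/2)(1 + e^{−u}) − (1 − e^{−u})]`
for every real `u` (`= 4z e^{−z}(z cosh z − sinh z)`, `z = u/2`). [cite: ItoiEtAl2023, Thm 3 (n = 0)] -/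
theorem kmsMomentRow_itoi3_n0_aux (u : ℝ) :
    0 ≤ u * (u / 2 * (1 + Real.exp (-u)) - (1 - Real.exp (-u))) := by
  obtain ⟨z, rfl⟩ : ∃ z, u = 2 * z := ⟨u / 2, by ring⟩
  have hθ : 0 ≤ z * (z * Real.cosh z - Real.sinh z) := by
    rcases le_total 0 z with hz | hz
    · exact mul_nonneg hz (mul_cosh_sub_sinh_nonneg hz)
    · have h' := mul_cosh_sub_sinh_nonneg (neg_nonneg.2 hz)
      rw [Real.cosh_neg, Real.sinh_neg] at h'
      exact mul_nonneg_of_nonpos_of_nonpos hz (by linarith)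
  have key : 2 * z * (2 * z / 2 * (1 + Real.exp (-(2 * z))) - (1 - Real.exp (-(2 * z)))) =
      4 * Real.exp (-z) * (z * (z * Real.cosh z - Real.sinh z)) := by
    rw [exp_neg_two_mul_dict, Real.cosh_eq, Real.sinh_eq]
    linear_combination (2 * z * (1 - z)) * exp_mul_exp_neg_dict z
  rw [key]
  exact mul_nonneg (mul_nonneg (by norm_num) (Real.exp_pos _).le) hθ

/-- **Dictionary member «Itoi–Ishimori–Sato–Sakamoto Thm 3, `n = 0` (upper bound)»**:
`⟨[A†,[H,A]]⟩ ≤ (β/2)⟨{[H,A]†,[H,A]}⟩`, i.e. the row `K = 2`, `p = (0, −1, ½)`, `q = (0, 1, ½)`: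
`0 ≤ (−u + ½u²) + e^{−u}(u + ½u²)` for every real `u` (`tanh z ≤ z`). [cite: ItoiEtAl2023, Thm 3 (n = 0)] -/
theorem kmsMomentRow_itoi3_n0 (u : ℝ) :
    0 ≤ (∑ k : Fin 3, (![0, -1, 1 / 2] : Fin 3 → ℝ) k * u ^ (k : ℕ)) +
      Real.exp (-u) * ∑ k : Fin 3, (![0, 1, 1 / 2] : Fin 3 → ℝ) k * u ^ (k : ℕ) := by
  have hE : (∑ k : Fin 3, (![0, -1, 1 / 2] : Fin 3 → ℝ) k * u ^ (k : ℕ)) +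
      Real.exp (-u) * ∑ k : Fin 3, (![0, 1, 1 / 2] : Fin 3 → ℝ) k * u ^ (k : ℕ) =
      u * (u / 2 * (1 + Real.exp (-u)) - (1 - Real.exp (-u))) := by
    simp [Fin.sum_univ_succ]
    ring
  rw [hE]
  exact kmsMomentRow_itoi3_n0_aux u

/-- Clean form of the member «Thm 3, `n = 0`, lower bound»:
`0 ≤ u·[(1 − e^{−u}) − (u/2 − u³/24)(1 + e^{−u})]` for every real `u`
(`= 4z e^{−z}(sinh z − (z − z³/3) cosh z)`, `z = u/2`). [cite: ItoiEtAl2023, Thm 3 (n = 0)] -/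
theorem kmsMomentRow_itoi3_n0_lower_aux (u : ℝ) :
    0 ≤ u * ((1 - Real.exp (-u)) - (u / 2 - u ^ 3 / 24) * (1 + Real.exp (-u))) := by
  obtain ⟨z, rfl⟩ : ∃ z, u = 2 * z := ⟨u / 2, by ring⟩
  have hθ : 0 ≤ z * (Real.sinh z - (z - z ^ 3 / 3) * Real.cosh z) := by
    rcases le_total 0 z with hz | hz
    · exact mul_nonneg hz (sinh_sub_taylor3_mul_cosh_nonneg hz)
    · have h' := sinh_sub_taylor3_mul_cosh_nonneg (neg_nonneg.2 hz)
      rw [Real.cosh_neg, Real.sinh_neg] at h'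
      have hS : (-z - (-z) ^ 3 / 3) = -(z - z ^ 3 / 3) := by ring
      rw [hS] at h'
      exact mul_nonneg_of_nonpos_of_nonpos hz (by linarith)
  have key : 2 * z * ((1 - Real.exp (-(2 * z))) - (2 * z / 2 - (2 * z) ^ 3 / 24) * (1 + Real.exp (-(2 * z)))) =
      4 * Real.exp (-z) * (z * (Real.sinh z - (z - z ^ 3 / 3) * Real.cosh z)) := by
    rw [exp_neg_two_mul_dict, Real.cosh_eq, Real.sinh_eq]
    linear_combination (2 * z * ((z - z ^ 3 / 3) - 1)) * exp_mul_exp_neg_dict z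
  rw [key]
  exact mul_nonneg (mul_nonneg (by norm_num) (Real.exp_pos _).le) hθ

/-- **Dictionary member «Itoi–Ishimori–Sato–Sakamoto Thm 3, `n = 0` (lower bound)»**:
`⟨[A†,[H,A]]⟩ ≥ (β/2)⟨{C¹†,C¹}⟩ − (1/3)(β/2)³⟨{C²†,C²}⟩`, `Cᵏ = ad_H^k A`, i.e. the row `K = 4`,
`p = (0, 1, −½, 0, 1/24)`, `q = (0, −1, −½, 0, 1/24)`:
`0 ≤ (u − ½u² + u⁴/24) + e^{−u}(−u − ½u² + u⁴/24)` for every real `u` (`z − z³/3 ≤ tanh z`).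
[cite: ItoiEtAl2023, Thm 3 (n = 0)] -/
theorem kmsMomentRow_itoi3_n0_lower (u : ℝ) :
    0 ≤ (∑ k : Fin 5, (![0, 1, -1 / 2, 0, 1 / 24] : Fin 5 → ℝ) k * u ^ (k : ℕ)) +
      Real.exp (-u) * ∑ k : Fin 5, (![0, -1, -1 / 2, 0, 1 / 24] : Fin 5 → ℝ) k * u ^ (k : ℕ) := by
  have hE : (∑ k : Fin 5, (![0, 1, -1 / 2, 0, 1 / 24] : Fin 5 → ℝ) k * u ^ (k : ℕ)) +
      Real.exp (-u) * ∑ k : Fin 5, (![0, -1, -1 / 2, 0, 1 / 24] : Fin 5 → ℝ) k * u ^ (k : ℕ) =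
      u * ((1 - Real.exp (-u)) - (u / 2 - u ^ 3 / 24) * (1 + Real.exp (-u))) := by
    simp [Fin.sum_univ_succ]
    ring
  rw [hE]
  exact kmsMomentRow_itoi3_n0_lower_aux u

/-- Clean form of the member «Thm 3, `n = 4`, upper bound»:
`0 ≤ u·[(u/2 − u³/24 + u⁵/240)(1 + e^{−u}) − (1 − e^{−u})]` for every real `u`
(`= 4z e^{−z}((z − z³/3 + 2z⁵/15) cosh z − sinh z)`, `z = u/2`). [cite: ItoiEtAl2023, Thm 3 (n = 4)] -/
theorem kmsMomentRow_itoi3_n4_aux (u : ℝ) :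
    0 ≤ u * ((u / 2 - u ^ 3 / 24 + u ^ 5 / 240) * (1 + Real.exp (-u)) - (1 - Real.exp (-u))) := by
  obtain ⟨z, rfl⟩ : ∃ z, u = 2 * z := ⟨u / 2, by ring⟩
  have hθ : 0 ≤ z * ((z - z ^ 3 / 3 + 2 * z ^ 5 / 15) * Real.cosh z - Real.sinh z) := by
    rcases le_total 0 z with hz | hz
    · exact mul_nonneg hz (taylor5_mul_cosh_sub_sinh_nonneg hz)
    · have h' := taylor5_mul_cosh_sub_sinh_nonneg (neg_nonneg.2 hz)
      rw [Real.cosh_neg, Real.sinh_neg] at h'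
      have hS : (-z - (-z) ^ 3 / 3 + 2 * (-z) ^ 5 / 15) = -(z - z ^ 3 / 3 + 2 * z ^ 5 / 15) := by ring
      rw [hS] at h'
      exact mul_nonneg_of_nonpos_of_nonpos hz (by linarith)
  have key : 2 * z * ((2 * z / 2 - (2 * z) ^ 3 / 24 + (2 * z) ^ 5 / 240) * (1 + Real.exp (-(2 * z))) -
      (1 - Real.exp (-(2 * z)))) =
      4 * Real.exp (-z) * (z * ((z - z ^ 3 / 3 + 2 * z ^ 5 / 15) * Real.cosh z - Real.sinh z)) := by
    rw [exp_neg_two_mul_dict, Real.cosh_eq, Real.sinh_eq]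
    linear_combination (2 * z * (1 - (z - z ^ 3 / 3 + 2 * z ^ 5 / 15))) * exp_mul_exp_neg_dict z
  rw [key]
  exact mul_nonneg (mul_nonneg (by norm_num) (Real.exp_pos _).le) hθ

/-- **Dictionary member «Itoi–Ishimori–Sato–Sakamoto Thm 3, `n = 4` (upper bound)»**:
`⟨[A†,[H,A]]⟩ ≤ (β/2)⟨{C¹†,C¹}⟩ − (1/3)(β/2)³⟨{C²†,C²}⟩ + (2/15)(β/2)⁵⟨{C³†,C³}⟩`, i.e. the row `K = 6`,
`p = (0, −1, ½, 0, −1/24, 0, 1/240)`, `q = (0, 1, ½, 0, −1/24, 0, 1/240)`: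
`0 ≤ (−u + ½u² − u⁴/24 + u⁶/240) + e^{−u}(u + ½u² − u⁴/24 + u⁶/240)` for every real `u`
(`tanh z ≤ z − z³/3 + 2z⁵/15`). [cite: ItoiEtAl2023, Thm 3 (n = 4)] -/
theorem kmsMomentRow_itoi3_n4 (u : ℝ) :
    0 ≤ (∑ k : Fin 7, (![0, -1, 1 / 2, 0, -1 / 24, 0, 1 / 240] : Fin 7 → ℝ) k * u ^ (k : ℕ)) +
      Real.exp (-u) * ∑ k : Fin 7, (![0, 1, 1 / 2, 0, -1 / 24, 0, 1 / 240] : Fin 7 → ℝ) k * u ^ (k : ℕ) := by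
  have hE : (∑ k : Fin 7, (![0, -1, 1 / 2, 0, -1 / 24, 0, 1 / 240] : Fin 7 → ℝ) k * u ^ (k : ℕ)) +
      Real.exp (-u) * ∑ k : Fin 7, (![0, 1, 1 / 2, 0, -1 / 24, 0, 1 / 240] : Fin 7 → ℝ) k * u ^ (k : ℕ) =
      u * ((u / 2 - u ^ 3 / 24 + u ^ 5 / 240) * (1 + Real.exp (-u)) - (1 - Real.exp (-u))) := by
    simp [Fin.sum_univ_succ]
    ring
  rw [hE]
  exact kmsMomentRow_itoi3_n4_aux u

end Members

end Literature.MathematicalPhysics.QuantumLattice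

/-! ### §3 The two spellings of `ad_H^k` -/

namespace Matrix

/-- **`adPow` is the iterated commutator map**: `adPow H k a = (X ↦ HX − XH)^[k] a` — the bridge between
`Matrix.adPow` (`SpectralCorrelationInequalities`, `GibbsKMSMomentRow`) and the `Function.iterate`
spelling of `GibbsKMSMomentCuts` / `InfVolFermionStateTorusLimitKMSMomentCuts` (Itoi et al.:
`C_A^k = [H, ⋯ [H, [H, A]] ⋯ ]`). [cite: ItoiEtAl2023, §2 (definition of C_A^k)] -/
theorem adPow_eq_commutator_iterate {n : Type*} [Fintype n] (H a : Matrix n n ℂ) (k : ℕ) :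
    adPow H k a = (fun X : Matrix n n ℂ => H * X - X * H)^[k] a := by
  induction k with
  | zero => rfl
  | succ k ih => rw [adPow_succ, Function.iterate_succ_apply', ← ih]

end Matrix
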